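import Literature.NumberTheory.LFunctions.RealCharacterDivisorSums
import HarnessLib

/-!
# The divisor sum `r = χ ∗ 1` of a real character on the multiples of a squarefree number

Topic `Literature/NumberTheory/LFunctions`, namespace `RealChar` (continuing
`RealCharacterDivisorSums.lean`, Davenport Ch. 6: `∑_{n ≤ t} r(n) = L(1, χ) t + O(q√t)`,
`abs_sum_charDivisorSum_sub_le`).  Everything in this file is PROVED (theorems only).  For a quadratic
character `χ ≠ χ₀ (mod q)`, a squarefree `d` and real `t > 0`:

  `|∑_{m ≤ t, d ∣ m} r(m) − L(1, χ) t ∏_{p ∣ d} ((1 + χ(p))/p − χ(p)/p²)| ≤ 5 q 2^{ω(d)} √t`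

(`RealChar.abs_sum_multiples_charDivisorSum_sub_le`).  So the sequence `(r(m))_{m ≤ t}` — total mass
`L(1,χ) t` — has the multiplicative density `g(p) = (1 + χ(p))/p − χ(p)/p²` on multiples of `p`, with
`1 − g(p) = (1 − 1/p)(1 − χ(p)/p)` (`RealChar.one_sub_localDensity`), the local factor of `(ζ L(·,χ))⁻¹`
at `1`, and a remainder uniform in `d`: exactly the input an upper-bound sieve needs to sift the
`r`-weighted integers.  The proof is the two-term recursion

  `∑_{m ≤ t, pd ∣ m} r(m) = (1 + χ(p)) ∑_{m ≤ t/p, d ∣ m} r(m) − χ(p) ∑_{m ≤ t/p², d ∣ m} r(m)`   (`p ∤ d` prime)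

(`RealChar.sum_multiples_prime_mul_eq`), which comes from the pointwise identity
`r(pm) = (1 + χ(p)) r(m) − χ(p) 𝟙_{p ∣ m} r(m/p)` (`RealChar.charDivisorSum_prime_mul`, i.e. the linear
recurrence `r(p^{k+2}) = (1 + χ(p)) r(p^{k+1}) − χ(p) r(p^k)` of the geometric sums `r(p^k) = ∑_{j ≤ k} χ(p)^j`
and multiplicativity), followed by induction on the prime factors of `d` starting from Davenport's
mean value; `(1 + χ(p))/√p + |χ(p)|/p ≤ 2/√2 + 1/2 < 2` gives the factor `2^{ω(d)}`.

## References

* H. Davenport, *Multiplicative Number Theory*, 2nd ed. (1980), Ch. 6, (4) (the case `d = 1`).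
  [cite: DavenportMNT1980, Ch. 6, (4)]
* H. L. Montgomery, R. C. Vaughan, *Multiplicative Number Theory I*, §11.2 (sums of `1 ∗ χ`). [MontgomeryVaughan2007]
-/

noncomputable section

open Finset Real ArithmeticFunction

namespace Literature.NumberTheory.LFunctions.RealChar

open Literature.NumberTheory.LFunctions.DirichletAbel

variable {q : ℕ} [NeZero q] (χ : DirichletCharacter ℂ q)

/-! ### The local recurrence -/

omit [NeZero q] in
/-- `r(p^{k+2}) = (1 + χ(p)) r(p^{k+1}) − χ(p) r(p^k)` (the geometric sums `∑_{j ≤ k} χ(p)^j`). [folklore] -/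
theorem charDivisorSum_prime_pow_succ_succ (hq : χ ^ 2 = 1) {p : ℕ} (hp : p.Prime) (k : ℕ) :
    charDivisorSum χ (p ^ (k + 2)) =
      (1 + reChar χ p) * charDivisorSum χ (p ^ (k + 1)) - reChar χ p * charDivisorSum χ (p ^ k) := by
  rw [charDivisorSum_prime_pow χ hq hp, charDivisorSum_prime_pow χ hq hp,
    charDivisorSum_prime_pow χ hq hp, sum_range_succ _ (k + 2), sum_range_succ _ (k + 1)]
  ring

omit [NeZero q] in
/-- **`r(pm) = (1 + χ(p)) r(m) − χ(p) 𝟙_{p ∣ m} r(m/p)`** for a prime `p` and `m ≥ 1`. [folklore] -/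
theorem charDivisorSum_prime_mul (hq : χ ^ 2 = 1) {p : ℕ} (hp : p.Prime) {m : ℕ} (hm : m ≠ 0) :
    charDivisorSum χ (p * m) =
      (1 + reChar χ p) * charDivisorSum χ m -
        reChar χ p * (if p ∣ m then charDivisorSum χ (m / p) else 0) := by
  have hmult := isMultiplicative_charDivisorSum χ hq
  -- `m = p^k m'`, `p ∤ m'`
  obtain ⟨k, m', hm', rfl⟩ := Nat.exists_eq_pow_mul_and_not_dvd hm p hp.ne_one
  have hm'0 : m' ≠ 0 := by rintro rfl; simp at hm
  have hcop : ∀ j : ℕ, Nat.Coprime (p ^ j) m' := fun j =>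
    (Nat.Coprime.pow_left j ((Nat.Prime.coprime_iff_not_dvd hp).mpr hm'))
  have hsplit : ∀ j : ℕ, charDivisorSum χ (p ^ j * m') = charDivisorSum χ (p ^ j) * charDivisorSum χ m' :=
    fun j => hmult.map_mul_of_coprime (hcop j)
  have e1 : p * (p ^ k * m') = p ^ (k + 1) * m' := by ring
  rw [e1, hsplit (k + 1), hsplit k]
  rcases k with _ | j
  · -- `p ∤ m`
    have hnd : ¬ p ∣ p ^ 0 * m' := by simpa using hm'
    rw [if_neg hnd, pow_zero, charDivisorSum_one, zero_add, pow_one, charDivisorSum_prime χ hq hp]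
    ring
  · -- `p ∣ m`, `m / p = p^j m'`
    have hd : p ∣ p ^ (j + 1) * m' := Dvd.dvd.mul_right (dvd_pow_self p (by omega)) m'
    have hdiv : p ^ (j + 1) * m' / p = p ^ j * m' := by
      rw [pow_succ, mul_assoc, mul_comm p, ← mul_assoc, Nat.mul_div_cancel _ hp.pos]
    rw [if_pos hd, hdiv, hsplit j, show j + 1 + 1 = j + 2 by ring,
      charDivisorSum_prime_pow_succ_succ χ hq hp j]
    ring

/-! ### Multiples of `p d` are `p` times multiples of `d` -/

omit [NeZero q] in
/-- Reindexing the multiples of `p d` in `[1, N]` as `p` times the multiples of `d` in `[1, N/p]` (`p ≥ 1`).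
[folklore] -/
theorem sum_filter_mul_dvd_eq {p : ℕ} (hp : 0 < p) (d N : ℕ) (f : ℕ → ℝ) :
    ∑ m ∈ (Ioc 0 N).filter (fun m => p * d ∣ m), f m =
      ∑ m ∈ (Ioc 0 (N / p)).filter (fun m => d ∣ m), f (p * m) := by
  have hset : (Ioc 0 N).filter (fun m => p * d ∣ m) =
      ((Ioc 0 (N / p)).filter (fun m => d ∣ m)).map ⟨fun m => p * m, mul_right_injective₀ hp.ne'⟩ := by
    ext m
    simp only [mem_filter, mem_Ioc, mem_map, Function.Embedding.coeFn_mk]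
    constructor
    · rintro ⟨⟨hm0, hmN⟩, k, hk⟩
      refine ⟨d * k, ⟨⟨?_, ?_⟩, dvd_mul_right d k⟩, ?_⟩
      · rcases Nat.eq_zero_or_pos (d * k) with h0 | h0
        · rw [hk, mul_assoc, h0, mul_zero] at hm0; omega
        · exact h0
      · rw [Nat.le_div_iff_mul_le hp, mul_comm, ← mul_assoc, ← hk]; exact hmN
      · rw [hk, mul_assoc]
    · rintro ⟨m₁, ⟨⟨hm₁0, hm₁N⟩, hdm⟩, rfl⟩
      refine ⟨⟨Nat.mul_pos hp hm₁0, ?_⟩, mul_dvd_mul_left p hdm⟩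
      rw [Nat.le_div_iff_mul_le hp] at hm₁N
      rw [mul_comm]; exact hm₁N
  rw [hset, sum_map]
  rfl

/-! ### The two-term recursion -/

omit [NeZero q] in
/-- **The recursion.** For a prime `p ∤ d` and every `N`:
`∑_{m ≤ N, pd ∣ m} r(m) = (1 + χ(p)) ∑_{m ≤ N/p, d ∣ m} r(m) − χ(p) ∑_{m ≤ N/p², d ∣ m} r(m)`. [folklore] -/
theorem sum_multiples_prime_mul_eq (hq : χ ^ 2 = 1) {p d : ℕ} (hp : p.Prime) (hpd : ¬ p ∣ d) (N : ℕ) :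
    ∑ m ∈ (Ioc 0 N).filter (fun m => p * d ∣ m), charDivisorSum χ m =
      (1 + reChar χ p) * ∑ m ∈ (Ioc 0 (N / p)).filter (fun m => d ∣ m), charDivisorSum χ m -
        reChar χ p * ∑ m ∈ (Ioc 0 (N / p / p)).filter (fun m => d ∣ m), charDivisorSum χ m := by
  rw [sum_filter_mul_dvd_eq hp.pos d N]
  -- pointwise identity
  have h1 : ∑ m ∈ (Ioc 0 (N / p)).filter (fun m => d ∣ m), charDivisorSum χ (p * m) =
      ∑ m ∈ (Ioc 0 (N / p)).filter (fun m => d ∣ m),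
        ((1 + reChar χ p) * charDivisorSum χ m -
          reChar χ p * (if p ∣ m then charDivisorSum χ (m / p) else 0)) := by
    refine sum_congr rfl fun m hm => ?_
    have hm0 : m ≠ 0 := by
      have := (mem_Ioc.mp (mem_filter.mp hm).1).1
      omega
    exact charDivisorSum_prime_mul χ hq hp hm0
  rw [h1, sum_sub_distrib, ← mul_sum, ← mul_sum]
  congr 1
  -- the multiples of `p` among the multiples of `d` in `[1, N/p]` are the multiples of `pd`
  have h2 : ∑ m ∈ (Ioc 0 (N / p)).filter (fun m => d ∣ m),
      (if p ∣ m then charDivisorSum χ (m / p) else 0) =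
      ∑ m ∈ (Ioc 0 (N / p)).filter (fun m => p * d ∣ m), charDivisorSum χ (m / p) := by
    rw [← sum_filter]
    refine sum_congr ?_ fun _ _ => rfl
    ext m
    simp only [mem_filter]
    constructor
    · rintro ⟨⟨hI, hd⟩, hpm⟩
      exact ⟨hI, Nat.Coprime.mul_dvd_of_dvd_of_dvd ((Nat.Prime.coprime_iff_not_dvd hp).mpr hpd) hpm hd⟩
    · rintro ⟨hI, hpdm⟩
      exact ⟨⟨hI, (dvd_mul_left d p).trans hpdm⟩, (dvd_mul_right p d).trans hpdm⟩
  rw [h2, sum_filter_mul_dvd_eq hp.pos d (N / p)]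
  congr 1
  refine sum_congr rfl fun m _ => ?_
  rw [Nat.mul_div_cancel_left m hp.pos]

/-! ### The local density -/

omit [NeZero q] in
/-- `1 − g(p) = (1 − 1/p)(1 − χ(p)/p)` for `g(p) = (1 + χ(p))/p − χ(p)/p²`. [folklore] -/
theorem one_sub_localDensity (p : ℕ) (c : ℝ) :
    1 - ((1 + c) / p - c / (p : ℝ) ^ 2) = (1 - 1 / (p : ℝ)) * (1 - c / p) := by
  rcases Nat.eq_zero_or_pos p with rfl | hp
  · simp
  · have hp0 : (p : ℝ) ≠ 0 := by exact_mod_cast hp.ne'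
    field_simp
    ring

/-! ### The mean value on multiples of a product of primes -/

/-- **`∑_{m ≤ t, d ∣ m} r(m)` for `d` a product of distinct primes.**  For a quadratic `χ ≠ χ₀ (mod q)`, a
finite set `s` of primes with product `d = ∏_{p ∈ s} p`, and real `t > 0`:
`|∑_{1 ≤ m ≤ t, d ∣ m} r(m) − L(1,χ) t ∏_{p ∈ s} ((1+χ(p))/p − χ(p)/p²)| ≤ 5 q 2^{#s} √t`.
[cite: DavenportMNT1980, Ch. 6, (4) (the case `s = ∅`), extended by the recursion `sum_multiples_prime_mul_eq`] -/
theorem abs_sum_multiples_charDivisorSum_sub_le_of_primes (hχ : χ ≠ 1) (hq : χ ^ 2 = 1)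
    {s : Finset ℕ} (hs : ∀ p ∈ s, p.Prime) {t : ℝ} (ht : 0 < t) :
    |∑ m ∈ (Ioc 0 ⌊t⌋₊).filter (fun m => (∏ p ∈ s, p) ∣ m), charDivisorSum χ m -
        (χ.LFunction 1).re * t * ∏ p ∈ s, ((1 + reChar χ p) / p - reChar χ p / (p : ℝ) ^ 2)| ≤
      5 * q * 2 ^ #s * Real.sqrt t := by
  classical
  induction s using Finset.induction_on generalizing t with
  | empty =>
    simp only [prod_empty, Nat.one_dvd, filter_true_of_mem (fun _ _ => trivial), card_empty, pow_zero,
      mul_one]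
    exact abs_sum_charDivisorSum_sub_le χ hχ hq ht
  | @insert p s hps ih =>
    have hp : p.Prime := hs p (mem_insert_self p s)
    have hs' : ∀ r ∈ s, r.Prime := fun r hr => hs r (mem_insert_of_mem hr)
    set d : ℕ := ∏ r ∈ s, r with hd
    have hpd : ¬ p ∣ d := by
      rw [hd]
      intro h
      obtain ⟨r, hr, hpr⟩ := (Prime.dvd_finsetProd_iff hp.prime _).mp h
      have : p = r := (Nat.prime_dvd_prime_iff_eq hp (hs' r hr)).mp hpr
      exact hps (this ▸ hr)
    rw [prod_insert hps, prod_insert hps, card_insert_of_notMem hps]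
    -- the recursion, in real form: `⌊t⌋/p = ⌊t/p⌋`, `⌊t⌋/p/p = ⌊t/p²⌋`
    have hp0 : (0 : ℝ) < p := by exact_mod_cast hp.pos
    have hrec := sum_multiples_prime_mul_eq χ hq hp hpd ⌊t⌋₊
    have hf1 : ⌊t⌋₊ / p = ⌊t / p⌋₊ := (Nat.floor_div_natCast t p).symm
    have hf2 : ⌊t / p⌋₊ / p = ⌊t / p / p⌋₊ := (Nat.floor_div_natCast (t / p) p).symm
    rw [hf1, hf2] at hrec
    rw [hrec]
    -- induction hypotheses at `t/p` and `t/p²`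
    have ht1 : 0 < t / p := div_pos ht hp0
    have ht2 : 0 < t / p / p := div_pos ht1 hp0
    have ih1 := ih hs' ht1
    have ih2 := ih hs' ht2
    set L : ℝ := (χ.LFunction 1).re
    set G : ℝ := ∏ r ∈ s, ((1 + reChar χ r) / r - reChar χ r / (r : ℝ) ^ 2)
    set c : ℝ := reChar χ p with hc
    set A1 : ℝ := ∑ m ∈ (Ioc 0 ⌊t / p⌋₊).filter (fun m => d ∣ m), charDivisorSum χ m
    set A2 : ℝ := ∑ m ∈ (Ioc 0 ⌊t / p / p⌋₊).filter (fun m => d ∣ m), charDivisorSum χ m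
    -- the main term splits along the recursion
    have hmain : L * t * (((1 + c) / p - c / (p : ℝ) ^ 2) * G) =
        (1 + c) * (L * (t / p) * G) - c * (L * (t / p / p) * G) := by
      field_simp
    rw [hmain]
    have hsplit : (1 + c) * A1 - c * A2 - ((1 + c) * (L * (t / p) * G) - c * (L * (t / p / p) * G)) =
        (1 + c) * (A1 - L * (t / p) * G) - c * (A2 - L * (t / p / p) * G) := by ring
    rw [hsplit]
    -- sizes of `c`
    have hc1 : |c| ≤ 1 := abs_reChar_le_one χ p
    have hc0 : 0 ≤ 1 + c := by have := (abs_le.mp hc1).1; linarith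
    have hc2 : 1 + c ≤ 2 := by have := (abs_le.mp hc1).2; linarith
    -- `√(t/p) ≤ √t/√2`, `√(t/p²) = √t/p ≤ √t/2`
    have hp2 : (2 : ℝ) ≤ p := by exact_mod_cast hp.two_le
    have hsq1 : Real.sqrt (t / p) ≤ Real.sqrt t / Real.sqrt 2 := by
      rw [Real.sqrt_div ht.le]
      exact div_le_div_of_nonneg_left (Real.sqrt_nonneg t) (Real.sqrt_pos.mpr two_pos)
        (Real.sqrt_le_sqrt hp2)
    have hsq2 : Real.sqrt (t / p / p) ≤ Real.sqrt t / 2 := by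
      rw [div_div, Real.sqrt_div ht.le, Real.sqrt_mul_self hp0.le]
      exact div_le_div_of_nonneg_left (Real.sqrt_nonneg t) two_pos hp2
    have hs2 : Real.sqrt 2 * Real.sqrt 2 = 2 := Real.mul_self_sqrt two_pos.le
    have hs2pos : 0 < Real.sqrt 2 := Real.sqrt_pos.mpr two_pos
    have hs2gt : (1.4 : ℝ) < Real.sqrt 2 := by
      rw [show (1.4 : ℝ) = Real.sqrt (1.4 ^ 2) by rw [Real.sqrt_sq (by norm_num)]]
      exact Real.sqrt_lt_sqrt (by norm_num) (by norm_num)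
    set K : ℝ := 5 * q * 2 ^ #s with hK
    have hK0 : 0 ≤ K := by rw [hK]; positivity
    have hst : 0 ≤ Real.sqrt t := Real.sqrt_nonneg t
    calc |(1 + c) * (A1 - L * (t / p) * G) - c * (A2 - L * (t / p / p) * G)|
        ≤ |(1 + c) * (A1 - L * (t / p) * G)| + |c * (A2 - L * (t / p / p) * G)| := abs_sub _ _
      _ = (1 + c) * |A1 - L * (t / p) * G| + |c| * |A2 - L * (t / p / p) * G| := by
          rw [abs_mul, abs_mul, abs_of_nonneg hc0]
      _ ≤ 2 * (K * Real.sqrt (t / p)) + 1 * (K * Real.sqrt (t / p / p)) :=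
          add_le_add (mul_le_mul hc2 ih1 (abs_nonneg _) (by norm_num))
            (mul_le_mul hc1 ih2 (abs_nonneg _) (by norm_num))
      _ ≤ 2 * (K * (Real.sqrt t / Real.sqrt 2)) + 1 * (K * (Real.sqrt t / 2)) := by
          gcongr
      _ = K * Real.sqrt t * (2 / Real.sqrt 2 + 1 / 2) := by
          field_simp
      _ ≤ K * Real.sqrt t * 2 := by
          refine mul_le_mul_of_nonneg_left ?_ (by positivity)
          rw [div_add_div _ _ hs2pos.ne' two_ne_zero, div_le_iff₀ (by positivity)]
          nlinarith
      _ = 5 * q * 2 ^ (#s + 1) * Real.sqrt t := by rw [hK, pow_succ]; ring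

/-- **The divisor sum of a real character on the multiples of a squarefree number.**  For a quadratic
`χ ≠ χ₀ (mod q)`, a squarefree `d` and real `t > 0`:
`|∑_{1 ≤ m ≤ t, d ∣ m} r(m) − L(1,χ) t ∏_{p ∣ d} ((1+χ(p))/p − χ(p)/p²)| ≤ 5 q 2^{ω(d)} √t`.
[cite: DavenportMNT1980, Ch. 6, (4) (the case `d = 1`), extended by the recursion `sum_multiples_prime_mul_eq`] -/
theorem abs_sum_multiples_charDivisorSum_sub_le (hχ : χ ≠ 1) (hq : χ ^ 2 = 1) {d : ℕ}
    (hd : Squarefree d) {t : ℝ} (ht : 0 < t) :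
    |∑ m ∈ (Ioc 0 ⌊t⌋₊).filter (fun m => d ∣ m), charDivisorSum χ m -
        (χ.LFunction 1).re * t *
          ∏ p ∈ d.primeFactors, ((1 + reChar χ p) / p - reChar χ p / (p : ℝ) ^ 2)| ≤
      5 * q * 2 ^ d.primeFactors.card * Real.sqrt t := by
  have h := abs_sum_multiples_charDivisorSum_sub_le_of_primes χ hχ hq
    (s := d.primeFactors) (fun p hp => Nat.prime_of_mem_primeFactors hp) ht
  rwa [Nat.prod_primeFactors_of_squarefree hd] at h

end Literature.NumberTheory.LFunctions.RealChar
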